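import Mathlib.Data.Nat.Log
import Literature.Computability.Complexity.TimeBounds
import Literature.Computability.Complexity.BoolEncodings
import Literature.Computability.Complexity.Classes
import Literature.Computability.Complexity.Nondeterministic
import Literature.Computability.Complexity.Randomized
import HarnessLib

-- provenance: harness21/H21/H21/Prelude/CplxCore/PCP.lean @ 399d27b (interim HEAD d8f2665); M5 mechanical rewrite
/-!
# Complexity core: probabilistically checkable proofs (PCP)

Trunk `CplxCore`, concept C17 (`PCP`; realises the notion `pcp_verifier`).

A *nonadaptive* `(r, q)`-PCP verifier for a language `L ⊆ {0,1}*` is a probabilistic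
polynomial-time algorithm which, on input `x` of length `n` and a coin string `ρ ∈ {0,1}^{r(n)}`,
first computes a list of at most `q(n)` positions of a proof string `π`, then reads the bits of
`π` at those positions and decides deterministically from `(x, ρ, answers)` whether to accept.
Completeness: `x ∈ L → ∃ π, Pr_ρ[accept] = 1`; soundness: `x ∉ L → ∀ π, Pr_ρ[accept] ≤ 1/2`.
`PCP r q` is the class of languages with such a verifier using at most `r n` coins and `q n`
queries (exact bounds; the customary `PCP(O(r), O(q))` is `⋃ c, PCP (c * r + c) (c * q + c)`
at use sites).

## Design

* Nonadaptive verifiers only (the PCP theorem and all statements consuming this notion are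
  about nonadaptive verifiers, and adaptive `q`-query verifiers are nonadaptive `2^q`-query
  ones), so no oracle machinery is needed: a verifier is the pair of *functions*
  `queries : input → coins → List ℕ` and `decide : input → coins → answers → Bool`, plus the
  coin budget `coins : ℕ → ℕ`. Proofs are total functions `π : ℕ → Bool` (positions never
  queried are irrelevant; a finite proof is padded by `false`).
* Polynomial time (`PCPVerifier.IsPolyTime`) is `PolyTimeComputable` (file `TimeBounds.lean`)
  of both maps, with tuples of bit strings presented through `boolPair` and the query list
  through `encodingListNatBool` (file `BoolEncodings.lean`), on **all** coin/answer strings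
  (as in `RandAlg.IsPolyTime`, file `Randomized.lean`), together with a polynomial coin
  budget.
* The acceptance probability is the real number `uniformProb (coins |x|) {ρ | accepts}` (file
  `Randomized.lean`).
* Mathlib has no PCP material (searched `PCP`, `probabilistically checkable`); nothing is
  duplicated.

## References

* S. Arora, S. Safra, *Probabilistic checking of proofs: a new characterization of NP*,
  J. ACM 45 (1998), Def. 2.1–2.2 (verifier, `PCP(r(n), q(n))`).
* S. Arora, C. Lund, R. Motwani, M. Sudan, M. Szegedy, *Proof verification and the hardness of
  approximation problems*, J. ACM 45 (1998), §2 (the PCP theorem `NP = PCP(log n, 1)`).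
* S. Arora, B. Barak, *Computational Complexity: A Modern Approach*, CUP 2009, §11.2
  (Def. 11.4: PCP verifier, nonadaptive, proofs of length `≤ q 2^r`; Remark 11.6:
  `PCP(r, q) ⊆ NTIME(2^{O(r)} q)`, hence `PCP(log n, 1) ⊆ NP`; Th. 11.5: the PCP theorem).
-/

namespace Literature.Computability.Complexity

open Turing _root_.Computability

/-! ### Nonadaptive PCP verifiers -/

/-- A *nonadaptive PCP verifier*: on input `x` and coin string `ρ` it computes the list of
proof positions `queries x ρ : List ℕ` to read, and then decides from `x`, `ρ` and the list of
answer bits whether to accept (`decide x ρ answers`). The field `coins n` is the number of random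
bits used on inputs of length `n`.
[Arora–Barak 2009, Def. 11.4 (nonadaptive case); Arora–Safra 1998, Def. 2.1] [cite: AroraBarak2009, Def. 11.4 (nonadaptive case] -/
structure PCPVerifier where
  /-- The number of coins used on inputs of length `n`. -/
  coins : ℕ → ℕ
  /-- The proof positions queried on input `x` with coin string `ρ` (nonadaptive). -/
  queries : List Bool → List Bool → List ℕ
  /-- The decision on input `x`, coin string `ρ` and the list of answer bits. -/
  decide : List Bool → List Bool → List Bool → Bool

namespace PCPVerifier

/-- `V.accepts x π ρ`: the verifier `V` accepts input `x` with oracle access to the proof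
`π : ℕ → Bool` on coin string `ρ`, i.e. `decide x ρ [π i | i ∈ queries x ρ]`.
[Arora–Barak 2009, Def. 11.4 (`V^π(x) = 1`)] [cite: AroraBarak2009, Def. 11.4 ( V^π(x] -/
def accepts (V : PCPVerifier) (x : List Bool) (π : ℕ → Bool) (ρ : List Bool) : Bool :=
  V.decide x ρ ((V.queries x ρ).map π)

/-- `V.acceptProb x π`: the probability, over a uniformly random coin string
`ρ ∈ {0,1}^{coins |x|}`, that `V` accepts `x` with proof `π` (a real number in `[0,1]`).
[Arora–Barak 2009, Def. 11.4 (`Pr[V^π(x) = 1]`); H21 `uniformProb`] [cite: AroraBarak2009, Def. 11.4 ( Pr V^π(x] -/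
noncomputable def acceptProb (V : PCPVerifier) (x : List Bool) (π : ℕ → Bool) : ℝ :=
  uniformProb (V.coins x.length) {ρ | V.accepts x π ρ = true}

/-- `V.IsPolyTime`: the verifier is polynomial-time — the query map `(x, ρ) ↦ queries x ρ`
(pair presented as `boolPair x ρ`, output through `encodingListNatBool`) and the decision map
`(x, ρ, a) ↦ decide x ρ a` (triple presented as `boolPair x (boolPair ρ a)`, output through
`encodeBool`) are `PolyTimeComputable`, and the coin budget is polynomially bounded.
Polynomial time is required on all coin and answer strings (cf. `RandAlg.IsPolyTime`).
[Arora–Barak 2009, Def. 11.4 ("polynomial-time"); Arora–Safra 1998, Def. 2.1] [cite: AroraBarak2009, Def. 11.4 ("polynomial-time"] -/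
def IsPolyTime (V : PCPVerifier) : Prop :=
  PolyTimeComputable (fun p : List Bool × List Bool => boolPair p.1 p.2)
      encodingListNatBool.encode (fun p => V.queries p.1 p.2) ∧
    PolyTimeComputable
      (fun p : List Bool × List Bool × List Bool => boolPair p.1 (boolPair p.2.1 p.2.2))
      encodeBool (fun p => V.decide p.1 p.2.1 p.2.2) ∧
    ∃ p : Polynomial ℕ, ∀ n, V.coins n ≤ p.eval n

/-- The acceptance probability is nonnegative. [H21 `uniformProb_nonneg`] [folklore] -/
theorem acceptProb_nonneg (V : PCPVerifier) (x : List Bool) (π : ℕ → Bool) :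
    0 ≤ V.acceptProb x π :=
  uniformProb_nonneg _ _

/-- The acceptance probability is at most `1`. [H21 `uniformProb_le_one`] [folklore] -/
theorem acceptProb_le_one (V : PCPVerifier) (x : List Bool) (π : ℕ → Bool) :
    V.acceptProb x π ≤ 1 :=
  uniformProb_le_one _ _

/-- Only the queried positions of the proof matter: two proofs agreeing on `queries x ρ` are
accepted on the same coin strings. [Arora–Barak 2009, Def. 11.4 (nonadaptivity)] [cite: AroraBarak2009, Def. 11.4 (nonadaptivity] -/
theorem accepts_congr (V : PCPVerifier) (x : List Bool) {π π' : ℕ → Bool} (ρ : List Bool)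
    (h : ∀ i ∈ V.queries x ρ, π i = π' i) : V.accepts x π ρ = V.accepts x π' ρ := by
  unfold accepts
  rw [List.map_congr_left h]

end PCPVerifier

/-! ### The classes `PCP(r, q)` -/

/-- `PCP r q`: the languages `L ⊆ {0,1}*` having a nonadaptive polynomial-time PCP verifier
that on inputs of length `n` uses at most `r n` coins and at most `q n` queries, with perfect
completeness (`x ∈ L → ∃ π, Pr[accept] = 1`) and soundness error `1/2`
(`x ∉ L → ∀ π, Pr[accept] ≤ 1/2`). Bounds are exact; `PCP(O(r), O(q))` is obtained as a union
over constants at use sites.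
[Arora–Safra 1998, Def. 2.2; Arora–Barak 2009, Def. 11.4] [cite: AroraSafra1998, Def. 2.2] -/
def PCP (r q : ℕ → ℕ) : Set (Language Bool) :=
  {L | ∃ V : PCPVerifier, V.IsPolyTime ∧ (∀ n, V.coins n ≤ r n) ∧
    (∀ x ρ, (V.queries x ρ).length ≤ q x.length) ∧
    (∀ x ∈ L, ∃ π, V.acceptProb x π = 1) ∧
    (∀ x ∉ L, ∀ π, V.acceptProb x π ≤ 1 / 2)}

/-- `PCP` is monotone in both the randomness and the query bound.
[Arora–Barak 2009, §11.2 (immediate from Def. 11.4)] [cite: AroraBarak2009, §11.2 (immediate from Def. 11.4] -/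
theorem PCP_mono {r r' q q' : ℕ → ℕ} (hr : ∀ n, r n ≤ r' n) (hq : ∀ n, q n ≤ q' n) :
    PCP r q ⊆ PCP r' q' := by
  rintro L ⟨V, hV, hc, hl, hcomp, hsound⟩
  exact ⟨V, hV, fun n => (hc n).trans (hr n), fun x ρ => (hl x ρ).trans (hq _), hcomp, hsound⟩

/-- `P ⊆ PCP(0, 0)`: a polynomial-time decidable language has a verifier using no coins and no
queries (it ignores the proof and decides the input itself).
[Arora–Barak 2009, §11.2.1 (`PCP(0, 0) = P`)] [cite: AroraBarak2009, §11.2.1 ( PCP(0  0] -/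
def P_subset_PCP_zero : Prop :=
  Classes.P ⊆ PCP 0 0

/-- The easy direction of the PCP theorem: `PCP(c log n + c, q) ⊆ NP` for constants `c, q` —
guess the (polynomially many) proof bits that can ever be queried and enumerate all
`2^{c log n + c} = poly(n)` coin strings.
[Arora–Barak 2009, Remark 11.6 (1); Arora–Safra 1998, Prop. 2.3] [cite: AroraBarak2009, Remark 11.6 (1] -/
def PCP_log_const_subset_NP : Prop :=
  ∀ (c q : ℕ),
    PCP (fun n => c * Nat.log 2 n + c) (fun _ => q) ⊆ Nondeterministic.NP

end Literature.Computability.Complexity
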